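import Summits.QuantumFields.BalabanUV.T4Continuum.Support.ShellMeasureLandauHolonomyReal

/-!
# `T4Continuum.ShellMeasureLandauHolonomyWeight` — THE WEIGHT SIDE OF THE S22 END: END-II's SM-L3 binder `hGW`
# (graded sectioned words for the Wilson WEIGHT plaquettes), in its own shape, for weight words `G p := holOf (ℓw p) Z`
# DEFINED from the SAME canonical Landau exponent field `Z` as the classifier holonomy of file 7″ — from 7″ §3's
# chart-ray data plus the displayed REAL STRUCTURE of file (A)
(cell `pub-balaban`, sub-cell `t4`, spine estimate NE7c (node U5b); NE7c formalisation swarm, crew seat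
`b2b-balaban-t4-ne7c-formalise-leaf-02` gen 4 — file (B) of the OFFER «S22 ROAD, THE WEIGHT SIDE»; imports this
lineage's `ShellMeasureLandauHolonomyReal` (file (A)) ONLY — hence 7″ `ShellMeasureLandauHolonomyChart`, 7′,
`ShellMeasureLevelAssembly`, `ShellMeasureWilsonMoving`; 0 `def`, 0 `def … : Prop`, 0 sorry)

HONEST FRAMING.  Finite four-torus programme, rung (B)+1 only — NOT infinite volume, NOT a mass gap, NOT the Clay
problem, NOT summit progress; (B), `BetaPertHyp`, (B^μ) not consumed.  NE7c (`T4IndicatorShell.ShellWeightBound`) is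
NOT PRINTED and NOT PROVED; «NE7c ⇐ the named binders».  Nothing printed in [Balaban1985Variational] is asserted: (P2),
(P4), (118)/(121), (44)+[4] Prop. 7, (46), (54), (75)/(103), the real structure and the unitarity TYPE of the bond
read-outs are TYPED HYPOTHESES, by name or displayed below; SM-L3 is NOT minted (c2) — it is RE-SOURCED to them.

WHAT THIS FILE DOES.  END-II (`ShellMeasureRootCompositionSU2.slotAC_realized_su2_of_levelData`, E2′
`ShellMeasureRootCompositionLevelZero.slotAC_realized_su2_of_levelData_cube`, the one-depth assembly
`ShellMeasureLevelAssembly.slotAntiConcentration_of_levelData`) asks, per window point `x ∈ W` and weight plaquette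
`p ∈ P_w`, a GRADED SECTIONED WORD: `∃ gw : List (MLetter A × ℝ × ℝ)`, every letter ADMISSIBLE
(`ShellMeasureWilsonMoving.MLetter.Good` — on `[0,1]`: `τ`-free, contracting exponential, size, Lipschitz constant),
`sSum gw ≤ s̄_p`, `lSum gw ≤ L̄_p`, `mdFro ≤ d̄_p`, evaluating at every contraction `c ∈ [0,1]` to `G p (c • x)`.  On the S22
road the weight words are the plaquette words of THE SAME bond variables as the classifier's holonomy: with file 7″'s
`holOf ℓs Z y = wordExp (ℓs.map fun ℓ => ℓ (Z y))` we set `G p := holOf (ℓw p) Z` for the weight read-outs `ℓw p`.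
* §1 `weightWord_of_consistentCurves` — END-II's `hGW` SHAPE for `G p := holOf (ℓw p) Z` from (i) 7″ §1's data: a
  family of holomorphic curves `Z_x` on the disc `‖σ‖ < Rad` (`1 < Rad`), bounded by `z̄`, RAY-CONSISTENT with `Z`
  (`Z_x c = Z (c • x)` on `[0,1]`), and (ii) REALITY ON THE SEGMENT: for `c ∈ [0,1]` every weight read-out of `Z (c • x)`
  is `τ`-free with `‖exp(·)‖ ≤ 1` — the (sk) TYPE of `ShellMeasureBlockWiring.hGW_of_blockBondData`, here for CLM
  read-outs (orientation absorbed in the sign of `ℓ`); all letters MOVING, sizes `s̄ = m·κ·z̄`, `L̄ = 3m·κ·z̄/(Rad − 1)`,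
  `d̄ = 0` (`ShellMeasureLevelAssembly.good_moving_of_bondData` per letter, BY NAME).
* §2 `landauCurve_along` — the canonical Landau exponent ALONG a holomorphic datum curve is holomorphic on the disc and
  bounded by `z̄ = (ε₄+a) + 4C₂B₀(ε₄+a)²` (7′ `solAt_along` + `corrAt_along`); `reality_of_readOuts` — (ii) from file
  (A)'s real structure: `Z (c • x) ∈ 𝓡𝒴` (`landauField_mem_real` at the real point `c • x`, `‖c • x‖ ≤ S`) and weight
  read-outs mapping `𝓡𝒴` into `{a ∣ τ a = 0 ∧ ‖exp a‖ ≤ 1}` («the minimiser is `G`-valued: its bond variables are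
  anti-Hermitian, their exponentials unitary» — (176) TYPE, located S18 (β); displayed, not instantiated).
* §3 `hGW_landau_chartRay` — THE CHART-RAY INSTANCE: END-II's `hGW` binder LITERALLY (`E = Fin n → ℝ`, window
  `W ⊆ closedBall 0 S`, `0 < S < r_Φ`) for the DEFINED weight words
  `G p := holOf (ℓw p) (fun y => landauExp C ι H (4C₂(ε₄+B₀b)²) (solAt 𝒢 0 W𝒱 ε₄ 0 (H₁ (Φ (cplx y))) + H₁ (Φ (cplx y))))`
  — the exponent field of 7″ §3 VERBATIM —, with `Rad = r_Φ/S`; binders = 7″ §3's (`hAN_landau_chartRay`) + file (A)'s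
  real structure + the unitarity TYPE of the weight read-outs.
AFTER THIS FILE the S22 END can carry BOTH plaquette functionals (classifier `hol`, weight `G`) as DEFINITIONS from one
exponent field; SM-L1 and SM-L3 are met in END-II's own shapes from displayed-TYPE data.  Remaining there: the two
dictionaries `hRdict`/`hudict`, the co-tests, SM-L4 `hE` (per-term pairs, this lineage's `ShellMeasureRayTermsAlong`),
SM-L2's inequality, and every S22 data binder — DISPLAYED, not discharged.  NOT an instance of Bałaban's minimiser;
(M1) realized ≠ NE7c; NE7c NOT PROVED; spine PROVED 0/9.  HONEST DEPENDENCY (cell): continuum YM on T⁴ ⇐ BetaPertH ∧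
nine spine estimates (0/9 proved); BetaPertH ⇐ (D1) ∧ (D4) ∧ CAP+tail; G-an2-4 gates asym, D1 and NE2/3/4.
-/

noncomputable section

open Set Metric NormedSpace

namespace Summit.QuantumFields.BalabanUV.T4Continuum.ShellMeasureLandauHolonomyWeight

open Literature.MathematicalPhysics.QuantumFieldTheory.Balaban1983to89
open B11Prop6Scheme (Prop4Hyp norm_arg_lt)
open ShellMeasureWilsonWords (wordExp wordExp_nil wordExp_cons)
open ShellMeasureWilsonTrace (TraceData)
open ShellMeasureWilsonMoving (MLetter mwordEval mdFro sSum lSum mwordEval_nil mwordEval_cons mdFro_nil mdFro_cons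
  sSum_nil sSum_cons lSum_nil lSum_cons)
open ShellMeasureLevelAssembly (good_moving_of_bondData)
open ShellMeasureLandauExponent (currentData_zero)
open ShellMeasureLandauHolonomy (solAt corrAt landauExp landauExp_apply solAt_along corrAt_along)
open ShellMeasureLandauHolonomyChart (holOf holOf_apply cplx ofReal_smul_cplx rayData_chart)
open ShellMeasureLandauHolonomyReal (landauField_mem_real)

variable {E : Type*} [AddCommGroup E] [Module ℝ E]
variable {𝒴 𝒴' 𝒳 𝒵 : Type*} [NormedAddCommGroup 𝒴] [NormedSpace ℂ 𝒴] [NormedAddCommGroup 𝒴'] [NormedSpace ℂ 𝒴']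
  [NormedAddCommGroup 𝒳] [NormedSpace ℂ 𝒳] [NormedAddCommGroup 𝒵] [NormedSpace ℂ 𝒵]
variable {A : Type*} [NormedRing A] [NormedAlgebra ℂ A] [CompleteSpace A]

/-! ## §0 Uniformly graded all-moving words (list bookkeeping) -/

section Lists

variable {β : Type*}

omit [NormedRing A] [NormedAlgebra ℂ A] [CompleteSpace A] in
/-- the size sum of a uniformly graded word is `length · a`. [folklore] -/
theorem sSum_map_uniform (F : β → MLetter A) (a L : ℝ) :
    ∀ l : List β, sSum (l.map fun b => (F b, a, L)) = l.length * a
  | [] => by simp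
  | b :: l => by
    rw [List.map_cons, sSum_cons, sSum_map_uniform F a L l, List.length_cons, Nat.cast_succ]; ring

omit [NormedRing A] [NormedAlgebra ℂ A] [CompleteSpace A] in
/-- the Lipschitz sum of a uniformly graded word is `length · L`. [folklore] -/
theorem lSum_map_uniform (F : β → MLetter A) (a L : ℝ) :
    ∀ l : List β, lSum (l.map fun b => (F b, a, L)) = l.length * L
  | [] => by simp
  | b :: l => by
    rw [List.map_cons, lSum_cons, lSum_map_uniform F a L l, List.length_cons, Nat.cast_succ]; ring

omit [NormedRing A] [NormedAlgebra ℂ A] [CompleteSpace A] in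
/-- the letters of a uniformly graded word. [folklore] -/
theorem map_fst_map_uniform (F : β → MLetter A) (a L : ℝ) (l : List β) :
    (l.map fun b => (F b, a, L)).map Prod.fst = l.map F := by
  rw [List.map_map]; rfl

omit [NormedAlgebra ℂ A] [CompleteSpace A] in
/-- an all-moving word has no frozen deviation. [folklore] -/
theorem mdFro_map_moving (X : β → ℝ → A) : ∀ l : List β, mdFro (l.map fun b => MLetter.moving (X b)) = 0
  | [] => mdFro_nil
  | b :: l => by rw [List.map_cons, mdFro_cons, mdFro_map_moving X l]; simp [MLetter.dev]

omit [NormedAlgebra ℂ A] [CompleteSpace A] in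
/-- an all-moving word evaluates at contraction `c` to the word of exponentials of its generators at `c`. [folklore] -/
theorem mwordEval_map_moving (X : β → ℝ → A) (c : ℝ) :
    ∀ l : List β, mwordEval c (l.map fun b => MLetter.moving (X b)) = wordExp (l.map fun b => X b c)
  | [] => by rw [List.map_nil, List.map_nil, mwordEval_nil, wordExp_nil]
  | b :: l => by
    rw [List.map_cons, List.map_cons, mwordEval_cons, wordExp_cons, mwordEval_map_moving X c l]; rfl

end Lists

/-! ## §1 END-II's `hGW` for `holOf` from ray-consistent holomorphic curves + reality on the segment -/

/-- **END-II's `hGW` FOR THE WEIGHT WORDS `holOf (ℓw p) Z` FROM RAY-CONSISTENT HOLOMORPHIC CURVES AND REALITY ON THE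
SEGMENT.**  Data: trace datum `T`; window `W ⊆ E`; weight plaquettes `P_w` with read-out lists `ℓw p` (`‖ℓ Y‖ ≤ κ‖Y‖`,
length `≤ m`); an exponent field `Z : E → 𝒴`; per window point a holomorphic curve `Z_x` on the disc `‖σ‖ < Rad`,
`1 < Rad`, with `‖Z_x σ‖ ≤ z̄`, RAY-CONSISTENT with the field (`Z_x c = Z (c • x)` for `c ∈ [0,1]`); and REALITY ON THE
SEGMENT: for `x ∈ W`, `c ∈ [0,1]`, `p ∈ P_w`, `ℓ ∈ ℓw p`: `τ (ℓ (Z (c • x))) = 0` and `‖exp (ℓ (Z (c • x)))‖ ≤ 1` (the (sk)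
TYPE).  CONCLUSION: END-II's `hGW` binder, literally, for `G p := holOf (ℓw p) Z` with the sizes `s̄_p = m·κ·z̄`,
`L̄_p = m·(3κz̄/(Rad−1))`, `d̄_p = 0` (`ShellMeasureLevelAssembly.good_moving_of_bondData` per letter). [folklore] -/
theorem weightWord_of_consistentCurves (T : TraceData A) {𝔭 : Type*} {W : Set E} {Pw : Finset 𝔭}
    (ℓw : 𝔭 → List (𝒴 →L[ℂ] A)) {κ : ℝ} (hκ : 0 ≤ κ) (hℓ : ∀ p ∈ Pw, ∀ ℓ ∈ ℓw p, ∀ Y, ‖ℓ Y‖ ≤ κ * ‖Y‖)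
    {m : ℕ} (hlen : ∀ p ∈ Pw, (ℓw p).length ≤ m) (Z : E → 𝒴) {Rad zbar : ℝ} (hRad1 : 1 < Rad) (hz : 0 ≤ zbar)
    (Zc : E → ℂ → 𝒴) (hZd : ∀ x ∈ W, DifferentiableOn ℂ (Zc x) (ball 0 Rad))
    (hZb : ∀ x ∈ W, ∀ σ ∈ ball (0 : ℂ) Rad, ‖Zc x σ‖ ≤ zbar)
    (hray : ∀ x ∈ W, ∀ c : ℝ, 0 ≤ c → c ≤ 1 → Zc x c = Z (c • x))
    (hreal : ∀ x ∈ W, ∀ c : ℝ, 0 ≤ c → c ≤ 1 → ∀ p ∈ Pw, ∀ ℓ ∈ ℓw p,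
      T.τ (ℓ (Z (c • x))) = 0 ∧ ‖exp (ℓ (Z (c • x)))‖ ≤ 1) :
    ∀ x ∈ W, ∀ p ∈ Pw, ∃ gw : List (MLetter A × ℝ × ℝ), (∀ y ∈ gw, y.1.Good T.τ y.2.1 y.2.2) ∧
      sSum gw ≤ m * (κ * zbar) ∧ lSum gw ≤ m * (3 * (κ * zbar) / (Rad - 1)) ∧ mdFro (gw.map Prod.fst) ≤ 0 ∧
      ∀ c : ℝ, 0 ≤ c → c ≤ 1 → mwordEval c (gw.map Prod.fst) = holOf (ℓw p) Z (c • x) := by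
  intro x hx p hp
  have hκz : 0 ≤ κ * zbar := mul_nonneg hκ hz
  have hL0 : 0 ≤ 3 * (κ * zbar) / (Rad - 1) := div_nonneg (by positivity) (by linarith)
  have hlen' : ((ℓw p).length : ℝ) ≤ m := Nat.cast_le.2 (hlen p hp)
  refine ⟨(ℓw p).map fun ℓ => (MLetter.moving fun c : ℝ => ℓ (Zc x c), κ * zbar, 3 * (κ * zbar) / (Rad - 1)),
    fun y hy => ?_, ?_, ?_, ?_, fun c hc0 hc1 => ?_⟩
  · -- every letter is admissible: (an) on the disc + reality on the segment
    obtain ⟨ℓ, hℓm, rfl⟩ := List.mem_map.1 hy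
    have h := good_moving_of_bondData T (𝓧 := fun σ => ℓ (Zc x σ)) (a := κ * zbar) hRad1
      (ℓ.differentiable.comp_differentiableOn (hZd x hx))
      (fun w hw => (hℓ p hp ℓ hℓm _).trans (mul_le_mul_of_nonneg_left (hZb x hx w hw) hκ))
      (fun c hc0 hc1 => by
        show T.τ (ℓ (Zc x c)) = 0
        rw [hray x hx c hc0 hc1]; exact (hreal x hx c hc0 hc1 p hp ℓ hℓm).1)
      (fun c hc0 hc1 => by
        show ‖exp (ℓ (Zc x c))‖ ≤ 1
        rw [hray x hx c hc0 hc1]; exact (hreal x hx c hc0 hc1 p hp ℓ hℓm).2)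
    simpa only [mul_one] using h
  · rw [sSum_map_uniform]; exact mul_le_mul_of_nonneg_right hlen' hκz
  · rw [lSum_map_uniform]; exact mul_le_mul_of_nonneg_right hlen' hL0
  · rw [map_fst_map_uniform, mdFro_map_moving]
  · rw [map_fst_map_uniform, mwordEval_map_moving, holOf_apply, hray x hx c hc0 hc1]

/-! ## §2 The canonical Landau exponent along a datum curve; reality of the weight read-outs on the segment -/

section Scheme

variable [CompleteSpace 𝒴] [CompleteSpace 𝒳]
  {𝒢 : 𝒵 →L[ℂ] 𝒴} {Λ : 𝒴 →L[ℂ] 𝒴} {W𝒱 : 𝒴 → 𝒵} {B₀ θ C₄ a₃ : ℝ}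

omit [CompleteSpace A] [NormedRing A] [NormedAlgebra ℂ A] in
/-- **THE CANONICAL LANDAU EXPONENT ALONG A HOLOMORPHIC DATUM CURVE.**  Under the S22 binders of file 7′
(`classifierWitness_of_prop6Scheme_sectC_canonical`: (P2) `h𝒢`/`hΛ`; (P4) `hW`; (118)/(121); holomorphic data
`J_σ`, `𝔄_σ` on the disc `‖σ‖ < Rad` with `‖J_σ‖ ≤ j`, `‖𝔄_σ‖ < a`; (44)+[4] Prop. 7 `hCq`/`hCd`; scaling `hι`; (46) `hH`;
(54)-smallness): the curve `σ ↦ Ψ̂(𝒜₁(σ) + 𝔄_σ) = landauExp C ι H (4C₂(ε₄+a)²) (solAt 𝒢 Λ W𝒱 ε₄ (J_σ) (𝔄_σ) + 𝔄_σ)` is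
holomorphic on the disc and bounded there by `z̄ = (ε₄+a) + B₀·4C₂(ε₄+a)²` ((57)'s shape). [folklore] -/
theorem landauCurve_along (h𝒢 : ∀ f, ‖𝒢 f‖ ≤ B₀ * ‖f‖) (hΛ : ∀ Y, ‖Λ Y‖ ≤ θ * ‖Y‖)
    (hW : Prop4Hyp W𝒱 C₄ a₃) (hB₀ : 0 ≤ B₀) (hC₄ : 0 ≤ C₄) (hθ : 0 ≤ θ) {j a ε₄ : ℝ} (hε₄ : 0 ≤ ε₄)
    (hdom : 2 * (ε₄ + a) ≤ a₃) (hself : B₀ * j + θ * (ε₄ + a) + B₀ * C₄ * (ε₄ + a) ^ 2 ≤ ε₄)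
    (hcontr : θ + 4 * B₀ * C₄ * (ε₄ + a) < 1) {Rad : ℝ} (hRad : 0 < Rad) {Jf : ℂ → 𝒵} {𝔄f : ℂ → 𝒴}
    (hJd : DifferentiableOn ℂ Jf (ball 0 Rad)) (h𝔄d : DifferentiableOn ℂ 𝔄f (ball 0 Rad))
    (hJ : ∀ σ ∈ ball (0 : ℂ) Rad, ‖Jf σ‖ ≤ j) (h𝔄 : ∀ σ ∈ ball (0 : ℂ) Rad, ‖𝔄f σ‖ < a)
    (hJ0 : Jf 0 = 0) (h𝔄0 : 𝔄f 0 = 0)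
    {C : 𝒴' → 𝒳} {C₂ R : ℝ} (hC₂ : 0 ≤ C₂) (hCq : ∀ Z : 𝒴', ‖Z‖ < R → ‖C Z‖ ≤ C₂ * ‖Z‖ ^ 2)
    (hCd : DifferentiableOn ℂ C (ball 0 R)) (ι : 𝒴 →L[ℂ] 𝒴') (hι : ∀ Y, ‖ι Y‖ ≤ ‖Y‖) (H : 𝒳 →L[ℂ] 𝒴)
    (hH : ∀ X, ‖H X‖ ≤ B₀ * ‖X‖) (hq : 9 * C₂ * B₀ * (ε₄ + a) < 1) (hRC : 3 * (ε₄ + a) ≤ R) :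
    DifferentiableOn ℂ (fun σ => landauExp C ι H (4 * C₂ * (ε₄ + a) ^ 2)
        (solAt 𝒢 Λ W𝒱 ε₄ (Jf σ) (𝔄f σ) + 𝔄f σ)) (ball 0 Rad) ∧
      ∀ σ ∈ ball (0 : ℂ) Rad, ‖landauExp C ι H (4 * C₂ * (ε₄ + a) ^ 2)
        (solAt 𝒢 Λ W𝒱 ε₄ (Jf σ) (𝔄f σ) + 𝔄f σ)‖ ≤ (ε₄ + a) + B₀ * (4 * C₂ * (ε₄ + a) ^ 2) := by
  obtain ⟨hXd, hX, -⟩ := solAt_along h𝒢 hΛ hW hB₀ hC₄ hθ hε₄ hdom hself hcontr hRad hJd h𝔄d hJ h𝔄 hJ0 h𝔄0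
  have hYd : DifferentiableOn ℂ (fun σ => solAt 𝒢 Λ W𝒱 ε₄ (Jf σ) (𝔄f σ) + 𝔄f σ) (ball 0 Rad) := hXd.add h𝔄d
  have hY : ∀ σ ∈ ball (0 : ℂ) Rad, ‖solAt 𝒢 Λ W𝒱 ε₄ (Jf σ) (𝔄f σ) + 𝔄f σ‖ < ε₄ + a := fun σ hσ =>
    norm_arg_lt (h𝔄 σ hσ) (hX σ hσ).1
  obtain ⟨hDd, hD⟩ := corrAt_along hC₂ hCq hCd ι hι H hB₀ hH hq hRC hYd hY
  refine ⟨?_, fun σ hσ => ?_⟩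
  · simp only [landauExp_apply]
    exact hYd.sub (H.differentiable.comp_differentiableOn hDd)
  · rw [landauExp_apply]
    have hDb : ‖corrAt C ι H (4 * C₂ * (ε₄ + a) ^ 2) (solAt 𝒢 Λ W𝒱 ε₄ (Jf σ) (𝔄f σ) + 𝔄f σ)‖ ≤
        4 * C₂ * (ε₄ + a) ^ 2 := mem_closedBall_zero_iff.1 (hD σ hσ).1
    calc _ ≤ ‖solAt 𝒢 Λ W𝒱 ε₄ (Jf σ) (𝔄f σ) + 𝔄f σ‖ +
          ‖H (corrAt C ι H (4 * C₂ * (ε₄ + a) ^ 2) (solAt 𝒢 Λ W𝒱 ε₄ (Jf σ) (𝔄f σ) + 𝔄f σ))‖ := norm_sub_le _ _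
      _ ≤ (ε₄ + a) + B₀ * (4 * C₂ * (ε₄ + a) ^ 2) :=
          add_le_add (hY σ hσ).le ((hH _).trans (mul_le_mul_of_nonneg_left hDb hB₀))

end Scheme

/-! ## §3 The chart-ray instance on `E = Fin n → ℝ`: END-II's `hGW` for the defined Landau weight words -/

section ChartRay

variable {n : ℕ} {ℬ : Type*} [NormedAddCommGroup ℬ] [NormedSpace ℂ ℬ] [CompleteSpace 𝒴] [CompleteSpace 𝒳]
  {𝒢 : 𝒵 →L[ℂ] 𝒴} {W𝒱 : 𝒴 → 𝒵} {B₀ C₄ a₃ : ℝ}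

omit [NormedSpace ℂ ℬ] in
/-- a point of a real ray inside the closed ball stays in the closed ball: `‖c • x‖ ≤ S` for `c ∈ [0,1]`, `‖x‖ ≤ S`.
[folklore] -/
theorem norm_smul_le_of_unit {x : Fin n → ℝ} {S c : ℝ} (hx : ‖x‖ ≤ S) (hc0 : 0 ≤ c) (hc1 : c ≤ 1) :
    ‖c • x‖ ≤ S := by
  rw [norm_smul, Real.norm_of_nonneg hc0]
  calc c * ‖x‖ ≤ 1 * ‖x‖ := mul_le_mul_of_nonneg_right hc1 (norm_nonneg _)
    _ = ‖x‖ := one_mul _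
    _ ≤ S := hx

omit [CompleteSpace A] in
/-- **REALITY OF THE WEIGHT READ-OUTS ON THE SEGMENT, FROM THE REAL STRUCTURE.**  Under the binders of file (A)'s
`landauField_mem_real` (the S22 point data + the real structure + `Φ (cplx y) ∈ 𝓡ℬ` at real chart points `‖y‖ ≤ S`) and
the unitarity TYPE of the weight read-outs — every `ℓ ∈ ℓw p`, `p ∈ P_w`, maps `𝓡𝒴` into `{a ∣ τ a = 0 ∧ ‖exp a‖ ≤ 1}`
((176): the bond variables of a `G`-valued configuration are anti-Hermitian, their exponentials unitary; orientation
absorbed in the sign of `ℓ`) —: along every real ray from a window point `x ∈ W ⊆ closedBall 0 S` the weight read-outs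
of the exponent field of 7″ §3 are `τ`-free with contracting exponentials (§1's `hreal`). [folklore] -/
theorem reality_of_readOuts (T : TraceData A) {𝔭 : Type*} {W : Set (Fin n → ℝ)} {Pw : Finset 𝔭} {S : ℝ}
    (hWS : W ⊆ closedBall (0 : Fin n → ℝ) S)
    (h𝒢 : ∀ f, ‖𝒢 f‖ ≤ B₀ * ‖f‖) (hW : Prop4Hyp W𝒱 C₄ a₃) (hB₀ : 0 < B₀) (hC₄ : 0 ≤ C₄)
    {b ε₄ : ℝ} (hε₄ : 0 ≤ ε₄) (hdom : 2 * (ε₄ + B₀ * b) ≤ a₃)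
    (hself : B₀ * C₄ * (ε₄ + B₀ * b) ^ 2 ≤ ε₄) (hcontr : 4 * B₀ * C₄ * (ε₄ + B₀ * b) < 1)
    (H₁ : ℬ →L[ℂ] 𝒴) (hH₁ : ∀ B, ‖H₁ B‖ ≤ B₀ * ‖B‖)
    {Φ : (Fin n → ℂ) → ℬ} {rΦ : ℝ} (hΦ : ∀ z ∈ ball (0 : Fin n → ℂ) rΦ, ‖Φ z‖ < b) (hSr : S < rΦ)
    {C : 𝒴' → 𝒳} {C₂ R : ℝ} (hC₂ : 0 ≤ C₂) (hCq : ∀ Z : 𝒴', ‖Z‖ < R → ‖C Z‖ ≤ C₂ * ‖Z‖ ^ 2)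
    (hCd : DifferentiableOn ℂ C (ball 0 R)) (ι : 𝒴 →L[ℂ] 𝒴') (hι : ∀ Y, ‖ι Y‖ ≤ ‖Y‖) (H : 𝒳 →L[ℂ] 𝒴)
    (hH : ∀ X, ‖H X‖ ≤ B₀ * ‖X‖) (hq : 9 * C₂ * B₀ * (ε₄ + B₀ * b) < 1) (hRC : 3 * (ε₄ + B₀ * b) ≤ R)
    -- the real structure (file (A))
    (𝓡𝒴 : AddSubgroup 𝒴) (h𝓡𝒴 : IsClosed (𝓡𝒴 : Set 𝒴)) (𝓡𝒵 : AddSubgroup 𝒵) (𝓡𝒴' : AddSubgroup 𝒴')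
    (𝓡𝒳 : AddSubgroup 𝒳) (h𝓡𝒳 : IsClosed (𝓡𝒳 : Set 𝒳)) (𝓡ℬ : AddSubgroup ℬ)
    (h𝒢r : ∀ f ∈ 𝓡𝒵, 𝒢 f ∈ 𝓡𝒴) (hWr : ∀ Y ∈ 𝓡𝒴, W𝒱 Y ∈ 𝓡𝒵) (hιr : ∀ Y ∈ 𝓡𝒴, ι Y ∈ 𝓡𝒴')
    (hHr : ∀ X ∈ 𝓡𝒳, H X ∈ 𝓡𝒴) (hCr : ∀ Z ∈ 𝓡𝒴', C Z ∈ 𝓡𝒳) (hH₁r : ∀ B ∈ 𝓡ℬ, H₁ B ∈ 𝓡𝒴)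
    (hΦr : ∀ y : Fin n → ℝ, ‖y‖ ≤ S → Φ (cplx y) ∈ 𝓡ℬ)
    -- the unitarity TYPE of the weight read-outs on real exponents
    (ℓw : 𝔭 → List (𝒴 →L[ℂ] A))
    (hℓr : ∀ p ∈ Pw, ∀ ℓ ∈ ℓw p, ∀ Y ∈ 𝓡𝒴, T.τ (ℓ Y) = 0 ∧ ‖exp (ℓ Y)‖ ≤ 1) :
    ∀ x ∈ W, ∀ c : ℝ, 0 ≤ c → c ≤ 1 → ∀ p ∈ Pw, ∀ ℓ ∈ ℓw p,
      T.τ (ℓ ((fun y => landauExp C ι H (4 * C₂ * (ε₄ + B₀ * b) ^ 2)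
        (solAt 𝒢 0 W𝒱 ε₄ (0 : 𝒵) (H₁ (Φ (cplx y))) + H₁ (Φ (cplx y)))) (c • x))) = 0 ∧
      ‖exp (ℓ ((fun y => landauExp C ι H (4 * C₂ * (ε₄ + B₀ * b) ^ 2)
        (solAt 𝒢 0 W𝒱 ε₄ (0 : 𝒵) (H₁ (Φ (cplx y))) + H₁ (Φ (cplx y)))) (c • x)))‖ ≤ 1 :=
  fun _ hx _ hc0 hc1 p hp ℓ hℓm => hℓr p hp ℓ hℓm _
    (landauField_mem_real h𝒢 hW hB₀ hC₄ hε₄ hdom hself hcontr H₁ hH₁ hΦ hSr hC₂ hCq hCd ι hι H hH hq hRC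
      𝓡𝒴 h𝓡𝒴 𝓡𝒵 𝓡𝒴' 𝓡𝒳 h𝓡𝒳 𝓡ℬ h𝒢r hWr hιr hHr hCr hH₁r hΦr
      (norm_smul_le_of_unit (mem_closedBall_zero_iff.1 (hWS hx)) hc0 hc1))

/-- **END-II's `hGW` ON THE CHART-RAY INSTANCE — THE DEFINED LANDAU WEIGHT WORDS, SM-L3 RE-SOURCED.**  Chart space
`E = Fin n → ℝ`; window `W ⊆ closedBall 0 S`, `0 < S < r_Φ`; the binders of 7″ §3's `hAN_landau_chartRay` — (P2) `h𝒢`;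
(P4) `hW`; (118)/(121) at `a = B₀b`, `j = 0`; (103) `hH₁`; (75) `hΦd`/`hΦ0`/`hΦ`; (44)+[4] Prop. 7 `hCq`/`hCd`; scaling
`hι`; (46) `hH`; (54)-smallness `hq`/`hRC` —; the trace datum `T`; the weight plaquettes `P_w` with read-outs `ℓw p`
(`‖ℓ Y‖ ≤ κ_w‖Y‖`, length `≤ m`); file (A)'s REAL STRUCTURE (`𝓡𝒴` closed, `𝓡𝒵`, `𝓡𝒴′`, `𝓡𝒳` closed, `𝓡ℬ`; the
scheme maps real; `Φ (cplx y) ∈ 𝓡ℬ` for `‖y‖ ≤ S`); the unitarity TYPE `hℓr` of the weight read-outs on `𝓡𝒴`.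
CONCLUSION: END-II's `hGW` binder, literally, for the DEFINED weight words
`G p := holOf (ℓw p) (fun y => landauExp C ι H (4C₂(ε₄+B₀b)²) (solAt 𝒢 0 W𝒱 ε₄ 0 (H₁ (Φ (cplx y))) + H₁ (Φ (cplx y))))`
— the word of weight read-outs of `Ψ̂(𝒜₁(y) + H₁B(y))`, the SAME exponent field as the classifier holonomy of 7″ §3 —
with sizes `s̄_p = m·κ_w·z̄`, `L̄_p = m·(3κ_w z̄/(r_Φ/S − 1))`, `d̄_p = 0`, `z̄ = (ε₄+B₀b) + 4C₂B₀(ε₄+B₀b)²`.  END-II's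
`hsw1` then reads `m·κ_w·z̄ ≤ 1` (a displayed smallness).  NOT an instance of Bałaban's minimiser (every analytic input
and the real structure are binders); NE7c NOT PROVED. [folklore] -/
theorem hGW_landau_chartRay (T : TraceData A) {𝔭 : Type*} {W : Set (Fin n → ℝ)} {Pw : Finset 𝔭} {S : ℝ}
    (hS : 0 < S) (hWS : W ⊆ closedBall (0 : Fin n → ℝ) S)
    (h𝒢 : ∀ f, ‖𝒢 f‖ ≤ B₀ * ‖f‖) (hW : Prop4Hyp W𝒱 C₄ a₃) (hB₀ : 0 < B₀) (hC₄ : 0 ≤ C₄)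
    {b ε₄ : ℝ} (hε₄ : 0 ≤ ε₄) (hdom : 2 * (ε₄ + B₀ * b) ≤ a₃)
    (hself : B₀ * C₄ * (ε₄ + B₀ * b) ^ 2 ≤ ε₄) (hcontr : 4 * B₀ * C₄ * (ε₄ + B₀ * b) < 1)
    (H₁ : ℬ →L[ℂ] 𝒴) (hH₁ : ∀ B, ‖H₁ B‖ ≤ B₀ * ‖B‖)
    {Φ : (Fin n → ℂ) → ℬ} {rΦ : ℝ} (hΦd : DifferentiableOn ℂ Φ (ball 0 rΦ)) (hΦ0 : Φ 0 = 0)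
    (hΦ : ∀ z ∈ ball (0 : Fin n → ℂ) rΦ, ‖Φ z‖ < b) (hSr : S < rΦ)
    {C : 𝒴' → 𝒳} {C₂ R : ℝ} (hC₂ : 0 ≤ C₂) (hCq : ∀ Z : 𝒴', ‖Z‖ < R → ‖C Z‖ ≤ C₂ * ‖Z‖ ^ 2)
    (hCd : DifferentiableOn ℂ C (ball 0 R)) (ι : 𝒴 →L[ℂ] 𝒴') (hι : ∀ Y, ‖ι Y‖ ≤ ‖Y‖) (H : 𝒳 →L[ℂ] 𝒴)
    (hH : ∀ X, ‖H X‖ ≤ B₀ * ‖X‖) (hq : 9 * C₂ * B₀ * (ε₄ + B₀ * b) < 1) (hRC : 3 * (ε₄ + B₀ * b) ≤ R)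
    -- weight read-outs
    (ℓw : 𝔭 → List (𝒴 →L[ℂ] A)) {κw : ℝ} (hκw : 0 ≤ κw) (hℓw : ∀ p ∈ Pw, ∀ ℓ ∈ ℓw p, ∀ Y, ‖ℓ Y‖ ≤ κw * ‖Y‖)
    {m : ℕ} (hlen : ∀ p ∈ Pw, (ℓw p).length ≤ m)
    -- the real structure (file (A)) and the unitarity TYPE of the weight read-outs
    (𝓡𝒴 : AddSubgroup 𝒴) (h𝓡𝒴 : IsClosed (𝓡𝒴 : Set 𝒴)) (𝓡𝒵 : AddSubgroup 𝒵) (𝓡𝒴' : AddSubgroup 𝒴')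
    (𝓡𝒳 : AddSubgroup 𝒳) (h𝓡𝒳 : IsClosed (𝓡𝒳 : Set 𝒳)) (𝓡ℬ : AddSubgroup ℬ)
    (h𝒢r : ∀ f ∈ 𝓡𝒵, 𝒢 f ∈ 𝓡𝒴) (hWr : ∀ Y ∈ 𝓡𝒴, W𝒱 Y ∈ 𝓡𝒵) (hιr : ∀ Y ∈ 𝓡𝒴, ι Y ∈ 𝓡𝒴')
    (hHr : ∀ X ∈ 𝓡𝒳, H X ∈ 𝓡𝒴) (hCr : ∀ Z ∈ 𝓡𝒴', C Z ∈ 𝓡𝒳) (hH₁r : ∀ B ∈ 𝓡ℬ, H₁ B ∈ 𝓡𝒴)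
    (hΦr : ∀ y : Fin n → ℝ, ‖y‖ ≤ S → Φ (cplx y) ∈ 𝓡ℬ)
    (hℓr : ∀ p ∈ Pw, ∀ ℓ ∈ ℓw p, ∀ Y ∈ 𝓡𝒴, T.τ (ℓ Y) = 0 ∧ ‖exp (ℓ Y)‖ ≤ 1) :
    ∀ x ∈ W, ∀ p ∈ Pw, ∃ gw : List (MLetter A × ℝ × ℝ), (∀ y ∈ gw, y.1.Good T.τ y.2.1 y.2.2) ∧
      sSum gw ≤ m * (κw * ((ε₄ + B₀ * b) + B₀ * (4 * C₂ * (ε₄ + B₀ * b) ^ 2))) ∧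
      lSum gw ≤ m * (3 * (κw * ((ε₄ + B₀ * b) + B₀ * (4 * C₂ * (ε₄ + B₀ * b) ^ 2))) / (rΦ / S - 1)) ∧
      mdFro (gw.map Prod.fst) ≤ 0 ∧
      ∀ c : ℝ, 0 ≤ c → c ≤ 1 → mwordEval c (gw.map Prod.fst) =
        holOf (ℓw p) (fun y => landauExp C ι H (4 * C₂ * (ε₄ + B₀ * b) ^ 2)
          (solAt 𝒢 0 W𝒱 ε₄ (0 : 𝒵) (H₁ (Φ (cplx y))) + H₁ (Φ (cplx y)))) (c • x) := by
  have hRad1 : 1 < rΦ / S := by rw [lt_div_iff₀ hS]; linarith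
  have hRad : 0 < rΦ / S := one_pos.trans hRad1
  have ha : 0 < B₀ * b := by
    have hb : 0 < b := (norm_nonneg _).trans_lt (hΦ 0 (mem_ball_self (hS.trans hSr)))
    exact mul_pos hB₀ hb
  have hz : 0 ≤ (ε₄ + B₀ * b) + B₀ * (4 * C₂ * (ε₄ + B₀ * b) ^ 2) := by positivity
  -- the scheme at `Λ = 0`, `J = 0`
  have hΛ : ∀ Y : 𝒴, ‖(0 : 𝒴 →L[ℂ] 𝒴) Y‖ ≤ 0 * ‖Y‖ := fun Y => by simp
  have hself' : B₀ * 0 + 0 * (ε₄ + B₀ * b) + B₀ * C₄ * (ε₄ + B₀ * b) ^ 2 ≤ ε₄ := by simpa using hself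
  have hcontr' : 0 + 4 * B₀ * C₄ * (ε₄ + B₀ * b) < 1 := by simpa using hcontr
  -- per window point: the coarse-field ray family through the chart map (7″ §3) and the Landau curve along it (§2)
  have hray := fun x (hx : x ∈ W) =>
    rayData_chart H₁ hH₁ hB₀ hΦd hΦ0 hΦ hS (mem_closedBall_zero_iff.1 (hWS hx))
  have hcurve := fun x (hx : x ∈ W) =>
    landauCurve_along h𝒢 hΛ hW hB₀.le hC₄ le_rfl hε₄ hdom hself' hcontr' hRad
      (currentData_zero (𝒵 := 𝒵) (rΦ / S)).1 (hray x hx).1 (currentData_zero (𝒵 := 𝒵) (rΦ / S)).2.1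
      (hray x hx).2.2.1 rfl (hray x hx).2.1 hC₂ hCq hCd ι hι H hH hq hRC
  exact weightWord_of_consistentCurves T ℓw hκw hℓw hlen
    (fun y => landauExp C ι H (4 * C₂ * (ε₄ + B₀ * b) ^ 2)
      (solAt 𝒢 0 W𝒱 ε₄ (0 : 𝒵) (H₁ (Φ (cplx y))) + H₁ (Φ (cplx y))))
    hRad1 hz
    (fun x σ => landauExp C ι H (4 * C₂ * (ε₄ + B₀ * b) ^ 2)
      (solAt 𝒢 0 W𝒱 ε₄ (0 : 𝒵) (H₁ (Φ (σ • cplx x))) + H₁ (Φ (σ • cplx x))))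
    (fun x hx => (hcurve x hx).1) (fun x hx => (hcurve x hx).2)
    (fun _ _ _ _ _ => by simp only [ofReal_smul_cplx])
    (reality_of_readOuts T hWS h𝒢 hW hB₀ hC₄ hε₄ hdom hself hcontr H₁ hH₁ hΦ hSr hC₂ hCq hCd ι hι H hH hq hRC
      𝓡𝒴 h𝓡𝒴 𝓡𝒵 𝓡𝒴' 𝓡𝒳 h𝓡𝒳 𝓡ℬ h𝒢r hWr hιr hHr hCr hH₁r hΦr ℓw hℓr)

end ChartRay

end Summit.QuantumFields.BalabanUV.T4Continuum.ShellMeasureLandauHolonomyWeight
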